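import Summits.QuantumFields.YangMills.Theorems.SwapVirialDeficitGnomonicTaylorAngleLine
import Summits.QuantumFields.YangMills.Theorems.SwapVirialDeficitBlowUpGnomonicIsotropyDefs
import HarnessLib

/-!
# Route `SwapVirialDeficit` (YangMills): THE FOLLOWER HESSIAN ACROSS HUB ANGLES — Lipschitz law in the angle (uniform down to the apex), the one-loop comparison
# between two hubs, and the APEX ISOTROPY of the follower determinant
# (cell ym-idea-1, skeleton ➎ `stub_core_tip` bricks (T2-hub)+(T3-det) of w2 g60's plan ∕ LEAD memo10b: the matching chain
# `(ψ, tilted ℓ) →[hub ψ→0] (0, ℓ) →[ℓ → ℓ_P̃] (0, ℓ_P̃) =[isotropy] (0, axial) →[hub 0→ψ′] shell`; free-hands support of ⟨stmt-QuantumFields-24197⟩ `SwapVirialDeficit.SwapGluedStiffness`)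

The follower Hessian families `A_F^{a}` of ✓`exists_gnoFolHessian` at the hubs `a = angUnit θ`, `a′ = angUnit θ′` (`θ, θ′ ∈ [0, π]`, i.e. `sin ≥ 0`) are read on the SAME
smooth function `Φ(θ, η) = gnoDeficitAng z χ θ ε η` of ✓`…AngleChartDefs` ∕ ✓`…TaylorAngleLine` (`gnoDeficit z χ (angUnit θ) ε = Φ(θ, ·)`), so:
* §1 ★★ `abs_gnoFolHessianForm_sub_le_angle` — `|⟪A_F^{θ} η v, v⟫ − ⟪A_F^{θ′} η v, v⟫| ≤ 122689728·L⁴·|θ − θ′|·‖v‖²` (✓`abs_hessianForm_sub_le_of_cubes` on `ℝ × GnoCoord L`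
  with the ambient cube ✓`gnoDeficitAng_third_bound_norm`, directions `(0, gnoFolEmb v)` via ✓`iteratedFDeriv_fibre_apply`); with ✓`abs_gnoFolHessianForm_sub_le` (same hub,
  two chart points) this gives the JOINT law ★★ `abs_gnoFolHessianForm_sub_le_joint`: `≤ (122689728|θ − θ′| + 44712000‖η − η′‖)·L⁴·‖v‖²`;
* §2 ★★★ `abs_log_det_gnoFolHessian_sub_le_joint` — `|log det A_F^{θ} η − log det A_F^{θ′} η′| ≤ 2·(3|Fol L|)·δ∕μ′` for `δ = (122689728|θ−θ′| + 44712000‖η−η′‖)L⁴ ≤ μ′∕2`,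
  `A_F^{θ′} η′` `μ′`-coercive (✓`abs_log_det_sub_log_det_le`) — the hub-and-letters MATCHING RADIUS of the follower one-loop factor, valid ACROSS the apex;
* §3 ★★ `gnoFolRot` (no definition: the block rotation `v ↦ (rot3 u (v_f))_f` packaged as a linear isometry equivalence of `V_F` inside the proofs), ★★★ `det_gnoFolHessian_apex_rot`
  — at the APEX hub `angUnit 0 = 1`: `det A_F^{0} (gnoRot u η) = det A_F^{0} η` for every unit quaternion `u` and every chart point `η` (LEAD g99's ✓`gnoDeficit_realHub_rot`
  read on the follower Hessian: the rotated family is the conjugate `R ∘ A ∘ R⁻¹` by the block isometry).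

HONEST LABEL: calculus ∕ linear algebra; the leader-side integrals and the assembly of `stub_core_tip`, the other region stubs, ⟨24197⟩ ∕ ⟨24194⟩ OPEN; own crux ⟨22884⟩
`LargeFieldMassRefinementTail` OPEN (blocked-on ⟨19935⟩); the Yang–Mills mass gap is NOT proved; no summit is proved by a line.  THEOREMS ONLY (0 `def`, 0 `sorry`),
standard axioms, no instances.  Width seat ym-line-sfw-p2-w2 g60 (cell ym-idea-1, free hands), `--supports stmt-QuantumFields-24197`.
References: [cite: Luscher1983, §2]; [cite: Breitung1994, Lemma 26]; [folklore].
-/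

set_option autoImplicit false
set_option synthInstance.maxSize 1024

noncomputable section

open MeasureTheory Quaternion Set Metric Module
open scoped Quaternion BigOperators ENNReal InnerProductSpace ContDiff
open Literature.MathematicalPhysics.QuantumLattice
open Literature.MathematicalPhysics.QuantumFieldTheory hiding SU2

namespace Summit.QuantumFields.YangMills.Theorems.SwapVirialDeficit.BlowUpRing

open Summit.QuantumFields.YangMills.Theorems.FemtoTransferGap
open Summit.QuantumFields.YangMills.Theorems.FemtoTransferGap.TT
open Summit.QuantumFields.YangMills.Theorems.SwapVirialDeficit.Gnomonic (normSq3 normSq3_nonneg contDiff_gnoDeficit contDiff_gnoDeficitAng gnoDeficitAng_third_bound_norm)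
open Summit.QuantumFields.YangMills.Theorems.QuantitativeLaplace (abs_hessianForm_sub_le_of_cubes abs_log_det_sub_log_det_le iteratedFDeriv_fibre_apply)

variable {L : ℕ} [NeZero L]

/-! ## §1 The follower Hessian form is Lipschitz in the hub angle -/

/-- The follower Hessian form at the hub `angUnit θ` (`sin θ ≥ 0`) read on the joint angle function: `⟪A η v, v⟫ = D²Φ(θ, η)[(0, gnoFolEmb v), (0, gnoFolEmb v)]`,
`Φ(q) = gnoDeficitAng z χ q.1 ε q.2`. [folklore] -/
theorem gnoFolHessianForm_eq_angle (z : Fin 3 → Bool) (χ : Site 3 L → SU2) {θ : ℝ} (hθ : 0 ≤ Real.sin θ) (ε : GnoSign L)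
    {A : GnoCoord L → GnoFol L →ₗ[ℝ] GnoFol L}
    (hamb : ∀ η (y : GnoFol L), ⟪A η y, y⟫_ℝ = iteratedFDeriv ℝ 2 (gnoDeficit z χ (angUnit θ) ε) η (fun _ => gnoFolEmb y))
    (η : GnoCoord L) (v : GnoFol L) :
    ⟪A η v, v⟫_ℝ = iteratedFDeriv ℝ 2 (fun q : ℝ × GnoCoord L => gnoDeficitAng z χ q.1 ε q.2) (θ, η) (fun _ => ((0 : ℝ), gnoFolEmb v)) := by
  have e : gnoDeficit z χ (angUnit θ) ε = fun η' => (fun q : ℝ × GnoCoord L => gnoDeficitAng z χ q.1 ε q.2) (θ, η') :=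
    funext fun η' => gnoDeficit_angUnit z χ hθ ε η'
  have h2 : (2 : WithTop ℕ∞) ≤ ((2 : ℕ∞) : WithTop ℕ∞) := le_rfl
  rw [hamb, e, iteratedFDeriv_fibre_apply (contDiff_gnoDeficitAng (n := 2) z χ ε) h2 θ η]

/-- ★★ **THE FOLLOWER HESSIAN FORM IS LIPSCHITZ IN THE HUB ANGLE, UNIFORMLY DOWN TO THE APEX**: for `θ, θ′` with `sin ≥ 0` and families `A`, `A′` of
✓`exists_gnoFolHessian` at the hubs `angUnit θ`, `angUnit θ′` (ambient identities): `|⟪A η v, v⟫ − ⟪A′ η v, v⟫| ≤ 122689728·L⁴·|θ − θ′|·‖v‖²`. [folklore] -/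
theorem abs_gnoFolHessianForm_sub_le_angle (z : Fin 3 → Bool) (χ : Site 3 L → SU2) {θ θ' : ℝ} (hθ : 0 ≤ Real.sin θ) (hθ' : 0 ≤ Real.sin θ') (ε : GnoSign L)
    {A A' : GnoCoord L → GnoFol L →ₗ[ℝ] GnoFol L}
    (hamb : ∀ η (y : GnoFol L), ⟪A η y, y⟫_ℝ = iteratedFDeriv ℝ 2 (gnoDeficit z χ (angUnit θ) ε) η (fun _ => gnoFolEmb y))
    (hamb' : ∀ η (y : GnoFol L), ⟪A' η y, y⟫_ℝ = iteratedFDeriv ℝ 2 (gnoDeficit z χ (angUnit θ') ε) η (fun _ => gnoFolEmb y))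
    (η : GnoCoord L) (v : GnoFol L) :
    |⟪A η v, v⟫_ℝ - ⟪A' η v, v⟫_ℝ| ≤ 122689728 * (L : ℝ) ^ 4 * |θ - θ'| * ‖v‖ ^ 2 := by
  rw [gnoFolHessianForm_eq_angle z χ hθ ε hamb η v, gnoFolHessianForm_eq_angle z χ hθ' ε hamb' η v]
  have h := abs_hessianForm_sub_le_of_cubes (contDiff_gnoDeficitAng (n := 3) z χ ε) convex_univ (A₃ := 40896576 * (L : ℝ) ^ 4) (by positivity)
    (fun p _ w => gnoDeficitAng_third_bound_norm z χ ε p w) (mem_univ ((θ, η) : ℝ × GnoCoord L)) (mem_univ ((θ', η) : ℝ × GnoCoord L)) ((0 : ℝ), gnoFolEmb v)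
  refine h.trans ?_
  have hd : ‖((θ, η) : ℝ × GnoCoord L) - (θ', η)‖ = |θ - θ'| := by
    rw [Prod.mk_sub_mk, sub_self, Prod.norm_def, norm_zero, Real.norm_eq_abs, max_eq_left (abs_nonneg _)]
  have hv : ‖(((0 : ℝ), gnoFolEmb v) : ℝ × GnoCoord L)‖ ≤ ‖v‖ := by
    rw [Prod.norm_def, norm_zero, max_eq_right (norm_nonneg _)]; exact norm_gnoFolEmb_le v
  rw [hd]
  have hT : ‖(((0 : ℝ), gnoFolEmb v) : ℝ × GnoCoord L)‖ ^ 2 ≤ ‖v‖ ^ 2 := pow_le_pow_left₀ (norm_nonneg _) hv 2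
  have hc : 0 ≤ 3 * (40896576 * (L : ℝ) ^ 4) * |θ - θ'| := by positivity
  calc 3 * (40896576 * (L : ℝ) ^ 4) * |θ - θ'| * ‖(((0 : ℝ), gnoFolEmb v) : ℝ × GnoCoord L)‖ ^ 2 ≤ 3 * (40896576 * (L : ℝ) ^ 4) * |θ - θ'| * ‖v‖ ^ 2 :=
        mul_le_mul_of_nonneg_left hT hc
    _ = 122689728 * (L : ℝ) ^ 4 * |θ - θ'| * ‖v‖ ^ 2 := by ring

/-- ★★ **THE JOINT LAW (hub angle AND chart point)**: `|⟪A η v, v⟫ − ⟪A′ η′ v, v⟫| ≤ (122689728·|θ − θ′| + 44712000·‖η − η′‖)·L⁴·‖v‖²` — the triangle through `⟪A′ η v, v⟫`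
(§1 for the hub, ✓`abs_gnoFolHessianForm_sub_le` for the letters at the hub `angUnit θ′`). [folklore] -/
theorem abs_gnoFolHessianForm_sub_le_joint (z : Fin 3 → Bool) (χ : Site 3 L → SU2) {θ θ' : ℝ} (hθ : 0 ≤ Real.sin θ) (hθ' : 0 ≤ Real.sin θ') (ε : GnoSign L)
    {A A' : GnoCoord L → GnoFol L →ₗ[ℝ] GnoFol L}
    (hamb : ∀ η (y : GnoFol L), ⟪A η y, y⟫_ℝ = iteratedFDeriv ℝ 2 (gnoDeficit z χ (angUnit θ) ε) η (fun _ => gnoFolEmb y))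
    (hamb' : ∀ η (y : GnoFol L), ⟪A' η y, y⟫_ℝ = iteratedFDeriv ℝ 2 (gnoDeficit z χ (angUnit θ') ε) η (fun _ => gnoFolEmb y))
    (η η' : GnoCoord L) (v : GnoFol L) :
    |⟪A η v, v⟫_ℝ - ⟪A' η' v, v⟫_ℝ| ≤ (122689728 * |θ - θ'| + 44712000 * ‖η - η'‖) * (L : ℝ) ^ 4 * ‖v‖ ^ 2 := by
  have h1 := abs_gnoFolHessianForm_sub_le_angle z χ hθ hθ' ε hamb hamb' η v
  have h2 := abs_gnoFolHessianForm_sub_le z χ (angUnit_ne_zero θ') ε hamb' η η' v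
  have htri : |⟪A η v, v⟫_ℝ - ⟪A' η' v, v⟫_ℝ| ≤ |⟪A η v, v⟫_ℝ - ⟪A' η v, v⟫_ℝ| + |⟪A' η v, v⟫_ℝ - ⟪A' η' v, v⟫_ℝ| := by
    have := abs_sub_le (⟪A η v, v⟫_ℝ) (⟪A' η v, v⟫_ℝ) (⟪A' η' v, v⟫_ℝ)
    exact this
  calc _ ≤ _ := htri
    _ ≤ 122689728 * (L : ℝ) ^ 4 * |θ - θ'| * ‖v‖ ^ 2 + 44712000 * (L : ℝ) ^ 4 * ‖η - η'‖ * ‖v‖ ^ 2 := add_le_add h1 h2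
    _ = (122689728 * |θ - θ'| + 44712000 * ‖η - η'‖) * (L : ℝ) ^ 4 * ‖v‖ ^ 2 := by ring

/-! ## §2 The one-loop comparison between two hubs -/

/-- ★★★ **THE ONE-LOOP COMPARISON OF THE FOLLOWER FACTOR ACROSS HUB ANGLES AND CHART POINTS**: `θ, θ′` with `sin ≥ 0`, families `A`, `A′` (symmetric, ambient identities)
at the hubs `angUnit θ`, `angUnit θ′`, `A′ η′` `μ′`-coercive (`μ′ > 0`), and `δ := (122689728|θ − θ′| + 44712000‖η − η′‖)·L⁴ ≤ μ′∕2`.  Then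
`|log det A η − log det A′ η′| ≤ 2·(3|Fol L|)·δ∕μ′` — the follower one-loop weight `det^{−1∕2}` changes by at most `exp(3|Fol L|·δ∕μ′)`: matching radius
`μ′∕(2·122689728·L⁴·3|Fol L|)` in the hub angle, THROUGH the apex. [cite: Breitung1994, Lemma 26] -/
theorem abs_log_det_gnoFolHessian_sub_le_joint (z : Fin 3 → Bool) (χ : Site 3 L → SU2) {θ θ' : ℝ} (hθ : 0 ≤ Real.sin θ) (hθ' : 0 ≤ Real.sin θ') (ε : GnoSign L)
    {A A' : GnoCoord L → GnoFol L →ₗ[ℝ] GnoFol L} (hAs : ∀ η, (A η).IsSymmetric) (hAs' : ∀ η, (A' η).IsSymmetric)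
    (hamb : ∀ η (y : GnoFol L), ⟪A η y, y⟫_ℝ = iteratedFDeriv ℝ 2 (gnoDeficit z χ (angUnit θ) ε) η (fun _ => gnoFolEmb y))
    (hamb' : ∀ η (y : GnoFol L), ⟪A' η y, y⟫_ℝ = iteratedFDeriv ℝ 2 (gnoDeficit z χ (angUnit θ') ε) η (fun _ => gnoFolEmb y))
    {η η' : GnoCoord L} {μ' : ℝ} (hμ : 0 < μ') (hcoer : ∀ y : GnoFol L, μ' * ‖y‖ ^ 2 ≤ ⟪A' η' y, y⟫_ℝ)
    (hnear : (122689728 * |θ - θ'| + 44712000 * ‖η - η'‖) * (L : ℝ) ^ 4 ≤ μ' / 2) :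
    |Real.log (LinearMap.det (A η)) - Real.log (LinearMap.det (A' η'))| ≤
      2 * (3 * (Fintype.card (Fol L) : ℝ)) * ((122689728 * |θ - θ'| + 44712000 * ‖η - η'‖) * (L : ℝ) ^ 4) / μ' := by
  have h := abs_log_det_sub_log_det_le (hAs η) (hAs' η') hμ (by positivity) hnear hcoer
    (fun y => abs_gnoFolHessianForm_sub_le_joint z χ hθ hθ' ε hamb hamb' η η' y)
  rw [← finrank_gnoFol_real (L := L)]
  exact h

/-! ## §3 Apex isotropy of the follower determinant -/

/-- ★★ **THE BLOCK ROTATION AS A LINEAR ISOMETRY EQUIVALENCE OF `V_F`** (`‖u‖ = 1`): `R_u y = (rot3 u (y_f))_f`, with `gnoFolEmb (R_u y) = gnoRot u (gnoFolEmb y)` and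
`gnoRot u (η + gnoFolEmb y) = gnoRot u η + gnoFolEmb (R_u y)`. [folklore] -/
theorem exists_gnoFolRot {u : ℍ} (hu : ‖u‖ = 1) :
    ∃ R : GnoFol L ≃ₗᵢ[ℝ] GnoFol L, (∀ y : GnoFol L, gnoFolBlocks (R y) = fun f => rot3 u (gnoFolBlocks y f)) ∧
      ∀ (η : GnoCoord L) (y : GnoFol L), gnoRot u (η + gnoFolEmb y) = gnoRot u η + gnoFolEmb (R y) := by
  -- the linear isometry
  let R₀ : GnoFol L →ₗᵢ[ℝ] GnoFol L :=
    { toFun := fun y => WithLp.toLp 2 (fun fk : Fol L × Fin 3 => rot3 u (gnoFolBlocks y fk.1) fk.2)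
      map_add' := fun y y' => by
        refine PiLp.ext fun fk => ?_
        have hb : gnoFolBlocks (y + y') fk.1 = gnoFolBlocks y fk.1 + gnoFolBlocks y' fk.1 := by funext k; rfl
        simp [hb, rot3_add]
      map_smul' := fun c y => by
        refine PiLp.ext fun fk => ?_
        have hb : gnoFolBlocks (c • y) fk.1 = c • gnoFolBlocks y fk.1 := by funext k; rfl
        simp [hb, rot3_smul]
      norm_map' := fun y => by
        have h : ‖(WithLp.toLp 2 (fun fk : Fol L × Fin 3 => rot3 u (gnoFolBlocks y fk.1) fk.2) : GnoFol L)‖ ^ 2 = ‖y‖ ^ 2 := by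
          rw [norm_sq_gnoFol, norm_sq_gnoFol]
          refine Finset.sum_congr rfl fun f _ => ?_
          have hb : gnoFolBlocks (WithLp.toLp 2 (fun fk : Fol L × Fin 3 => rot3 u (gnoFolBlocks y fk.1) fk.2) : GnoFol L) f = rot3 u (gnoFolBlocks y f) := by
            funext k; rfl
          rw [hb, normSq3_rot3 hu]
        exact (sq_eq_sq₀ (norm_nonneg _) (norm_nonneg _)).1 h }
  have hfin : finrank ℝ (GnoFol L) = finrank ℝ (GnoFol L) := rfl
  refine ⟨R₀.toLinearIsometryEquiv hfin, fun y => ?_, fun η y => ?_⟩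
  · funext f k; rfl
  · rw [gnoFolEmb_apply, gnoFolEmb_apply]
    simp only [gnoRot, Prod.fst_add, Prod.snd_add, add_zero]
    refine Prod.ext (Prod.ext ?_ ?_) (Prod.ext ?_ ?_)
    · simp
    · simp
    · simp
    · funext f
      show rot3 u (η.2.2 f + gnoFolBlocks y f) = rot3 u (η.2.2 f) + gnoFolBlocks ((R₀.toLinearIsometryEquiv hfin) y) f
      rw [rot3_add]
      rfl

/-- ★★★ **APEX ISOTROPY OF THE FOLLOWER DETERMINANT**: at the apex hub `angUnit 0 = 1`, for a central character, every unit quaternion `u` and every chart point `η`,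
`det A_F (gnoRot u η) = det A_F η` — for any family `A_F` of ✓`exists_gnoFolHessian` at the hub `(1 : ℍ)` (symmetric, form identity).  LEAD g99's ✓`gnoDeficit_realHub_rot`
makes `y ↦ F̂(gnoRot u η + gnoFolEmb (R_u y))` equal to `y ↦ F̂(η + gnoFolEmb y)`, so the rotated Hessian is the conjugate `R_u ∘ A_F η ∘ R_u⁻¹`. [folklore] -/
theorem det_gnoFolHessian_apex_rot (z : Fin 3 → Bool) {χ : Site 3 L → SU2} (hχ : ∀ (x : Site 3 L) (k : SU2), k * χ x = χ x * k) (ε : GnoSign L)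
    {A : GnoCoord L → GnoFol L →ₗ[ℝ] GnoFol L} (hAs : ∀ η, (A η).IsSymmetric)
    (hAyy : ∀ η (y : GnoFol L), ⟪A η y, y⟫_ℝ = iteratedFDeriv ℝ 2 (fun y' : GnoFol L => gnoDeficit z χ ((1 : ℝ) : ℍ) ε (η + gnoFolEmb y')) 0 (fun _ => y))
    {u : ℍ} (hu : ‖u‖ = 1) (η : GnoCoord L) :
    LinearMap.det (A (gnoRot u η)) = LinearMap.det (A η) := by
  obtain ⟨R, hRb, hRη⟩ := exists_gnoFolRot (L := L) hu
  -- the rotated follower restriction is the original composed with `R`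
  have hfun : (fun y' : GnoFol L => gnoDeficit z χ ((1 : ℝ) : ℍ) ε (η + gnoFolEmb y')) =
      (fun y' : GnoFol L => gnoDeficit z χ ((1 : ℝ) : ℍ) ε (gnoRot u η + gnoFolEmb y')) ∘ (R : GnoFol L → GnoFol L) := by
    funext y'
    simp only [Function.comp_apply]
    rw [← hRη η y', gnoDeficit_realHub_rot z hχ one_ne_zero hu]
  -- Hessian forms: `⟪A η y, y⟫ = ⟪A (gnoRot u η) (R y), R y⟫`
  have hform : ∀ y : GnoFol L, ⟪A η y, y⟫_ℝ = ⟪A (gnoRot u η) (R y), R y⟫_ℝ := fun y => by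
    rw [hAyy, hAyy, hfun]
    have hG : ContDiff ℝ 2 (fun y' : GnoFol L => gnoDeficit z χ ((1 : ℝ) : ℍ) ε (gnoRot u η + gnoFolEmb y')) :=
      contDiff_gnoDeficit_fol (n := 2) z χ (by exact_mod_cast one_ne_zero) ε _
    have h2 : ((2 : ℕ) : WithTop ℕ∞) ≤ ((2 : ℕ∞) : WithTop ℕ∞) := le_rfl
    rw [show (R : GnoFol L → GnoFol L) = ((R : GnoFol L ≃ₗᵢ[ℝ] GnoFol L).toLinearIsometry.toContinuousLinearMap : GnoFol L → GnoFol L) from rfl,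
      ContinuousLinearMap.iteratedFDeriv_comp_right _ hG _ h2]
    simp
  -- as operators: `A η = R⁻¹ ∘ A (gnoRot u η) ∘ R`
  set Rl : GnoFol L →ₗ[ℝ] GnoFol L := (R : GnoFol L ≃ₗᵢ[ℝ] GnoFol L).toLinearEquiv.toLinearMap with hRl
  set Rli : GnoFol L →ₗ[ℝ] GnoFol L := (R : GnoFol L ≃ₗᵢ[ℝ] GnoFol L).symm.toLinearEquiv.toLinearMap with hRli
  have hconj_symm : (Rli ∘ₗ A (gnoRot u η) ∘ₗ Rl).IsSymmetric := by
    intro y w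
    simp only [hRl, hRli, LinearMap.coe_comp, Function.comp_apply, LinearEquiv.coe_coe, LinearIsometryEquiv.coe_toLinearEquiv]
    rw [← LinearIsometryEquiv.inner_map_map R, LinearIsometryEquiv.apply_symm_apply, hAs, ← LinearIsometryEquiv.inner_map_map R (x := y),
      LinearIsometryEquiv.apply_symm_apply]
  have hforms : ∀ y : GnoFol L, ⟪(Rli ∘ₗ A (gnoRot u η) ∘ₗ Rl - A η) y, y⟫_ℝ = 0 := fun y => by
    rw [LinearMap.sub_apply, inner_sub_left, hform y]
    simp only [hRl, hRli, LinearMap.coe_comp, Function.comp_apply, LinearEquiv.coe_coe, LinearIsometryEquiv.coe_toLinearEquiv]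
    rw [← LinearIsometryEquiv.inner_map_map R (x := R.symm _), LinearIsometryEquiv.apply_symm_apply, sub_self]
  have hsub_symm : (Rli ∘ₗ A (gnoRot u η) ∘ₗ Rl - A η).IsSymmetric := hconj_symm.sub (hAs η)
  have heq : Rli ∘ₗ A (gnoRot u η) ∘ₗ Rl = A η := by
    have h0 := (LinearMap.IsSymmetric.inner_map_self_eq_zero hsub_symm).1 hforms
    exact sub_eq_zero.1 h0
  -- determinants
  have hdet := congrArg LinearMap.det heq
  rw [LinearMap.det_comp, LinearMap.det_comp] at hdet
  have hRR : LinearMap.det Rli * LinearMap.det Rl = 1 := by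
    rw [← LinearMap.det_comp]
    have : Rli ∘ₗ Rl = LinearMap.id := by
      apply LinearMap.ext; intro y
      simp [hRl, hRli]
    rw [this, LinearMap.det_id]
  rw [← hdet]
  calc LinearMap.det (A (gnoRot u η)) = (LinearMap.det Rli * LinearMap.det Rl) * LinearMap.det (A (gnoRot u η)) := by rw [hRR, one_mul]
    _ = LinearMap.det Rli * (LinearMap.det (A (gnoRot u η)) * LinearMap.det Rl) := by ring

end Summit.QuantumFields.YangMills.Theorems.SwapVirialDeficit.BlowUpRing

end
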